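import Mathlib
import Summits.RiemannHypothesis.RiemannHypothesis.Theorems.WeilParityOffLineParityDetectionTorusGramIntegrals
import Summits.RiemannHypothesis.RiemannHypothesis.Theorems.WeilParityOffLineParityDetectionTorusGramForms
import Summits.RiemannHypothesis.RiemannHypothesis.Theorems.WeilParityOffLineParityDetectionTorusGramCutoff
import HarnessLib

/-!
# Assembly lemmas for stub TORUS-SEP: classes of absolute ordinates, the gaining profile, and the
# degenerate top layer

Route `WeilParity`, crux `OffLineParityDetection` (item stmt-RiemannHypothesis-15431), line
`registered`, stub `stub_torusTopHeavySeparated` (TORUS-SEP).  No zeta facts, no definitions.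

* `torusSep_gain_classes` (TORUS-analysis §1.2): the mirror-pairing form of a real profile folds
  onto the ABSOLUTE ordinates,
  `gain(a, f) = Σ_{g ∈ |Im T|} m_g (⟨f, c_g⟩² - ⟨f, s_g⟩²)`, `m_g = Σ_{ρ ∈ T, |Im ρ| = g} w(ρ)`,
  with `c_g(u) = e^{-ηu} cos(g(u-a))`, `s_g(u) = e^{-ηu} sin(g(u-a))`.
* `torusSep_profile` : the test profile `p = Σ_i α_i c_{g_i}` is smooth, `|p| ≤ (Σ|α_i|) e^{-ηu}`,
  and its energy and pairings with the two families are the expected finite sums of Gram entries.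
* `torusSep_degenerate` : the registered conclusion for a top layer all of whose ordinates vanish
  (`gain(0, f) = (Σ w) (∫ f e^{-ηu})² ≥ 0`, danger bound `D = 0`, gaining profile a cut-off of
  `e^{-ηu}`).

Everything is folklore and fully proved.
-/

set_option linter.dupNamespace false

noncomputable section

namespace Summit.RiemannHypothesis.RiemannHypothesis.Theorems.WeilParityOffLineParityDetection

open MeasureTheory Set Filter Finset
open scoped Topology

/-! ## Folding onto absolute ordinates -/

/-- **Classes of absolute ordinates** (TORUS-analysis §1.2): for a continuous compactly supported
real `f`, `Re ρ = 1/2 + η` on `T`,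
`Σ_{ρ∈T} w(ρ) Re(e^{2i(Im ρ)a} F_f(ρ)²) = Σ_{g ∈ |Im T|} (Σ_{|Im ρ| = g} w(ρ)) (⟨f,c_g⟩² - ⟨f,s_g⟩²)`.
[folklore] -/
theorem torusSep_gain_classes {η : ℝ} (T : Finset ℂ) (hTre : ∀ ρ ∈ T, ρ.re = 1 / 2 + η)
    (w : ℂ → ℝ) (a : ℝ) {f : ℝ → ℝ} (hf : Continuous f) (hfs : HasCompactSupport f) :
    ∑ ρ ∈ T, w ρ * (Complex.exp (2 * (ρ.im : ℂ) * (a : ℂ) * Complex.I) *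
        (∫ u in Ioi (0 : ℝ), (f u : ℂ) * Complex.exp (-((ρ - 1 / 2) * (u : ℂ)))) ^ 2).re =
      ∑ g ∈ T.image (fun ρ : ℂ ↦ |ρ.im|), (∑ ρ ∈ T.filter (fun ρ : ℂ ↦ |ρ.im| = g), w ρ) *
        ((∫ u in Ioi (0 : ℝ), f u * (Real.exp (-(η * u)) * Real.cos (g * (u - a)))) ^ 2 -
          (∫ u in Ioi (0 : ℝ), f u * (Real.exp (-(η * u)) * Real.sin (g * (u - a)))) ^ 2) := by
  classical
  rw [Finset.sum_congr rfl fun ρ hρ ↦ by rw [torusSep_re_phase_laplace_sq_abs hf hfs (hTre ρ hρ) a]]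
  rw [← Finset.sum_fiberwise_of_maps_to (g := fun ρ : ℂ ↦ |ρ.im|) (t := T.image fun ρ : ℂ ↦ |ρ.im|)
    (fun ρ hρ ↦ Finset.mem_image_of_mem _ hρ)]
  refine Finset.sum_congr rfl fun g _ ↦ ?_
  rw [Finset.sum_mul]
  refine Finset.sum_congr rfl fun ρ hρ ↦ ?_
  rw [(Finset.mem_filter.1 hρ).2]

/-- Sums over the class finset as sums over its subtype. [folklore] -/
theorem torusSep_sum_classes_coe (G : Finset ℝ) (φ : ℝ → ℝ) :
    ∑ g ∈ G, φ g = ∑ i : ↥G, φ i.1 :=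
  (Finset.sum_coe_sort G φ).symm

/-! ## The test profile -/

/-- **The test profile** `p(u) = Σ_i α_i e^{-ηu} cos(g_i(u-a))` (finite index type): smooth, bounded
by `(Σ|α_i|) e^{-ηu}`, with energy `∫₀^∞ p² = Σ_{ij} α_i α_j ⟨c_i, c_j⟩` and pairings
`∫₀^∞ p c_i = Σ_j α_j ⟨c_j, c_i⟩`, `∫₀^∞ p s_i = Σ_j α_j ⟨c_j, s_i⟩` in closed form. [folklore] -/
theorem torusSep_profile {ι : Type*} [Fintype ι] {η : ℝ} (hη : 0 < η) (a : ℝ) (g : ι → ℝ)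
    (α : ι → ℝ) {H Q : ℝ → ℝ}
    (hH : ∀ ω, H ω = (2 * η * Real.cos (ω * a) + ω * Real.sin (ω * a)) / (4 * η ^ 2 + ω ^ 2))
    (hQ : ∀ ω, Q ω = (ω * Real.cos (ω * a) - 2 * η * Real.sin (ω * a)) / (4 * η ^ 2 + ω ^ 2))
    {p : ℝ → ℝ} (hp : ∀ u, p u = ∑ i, α i * (Real.exp (-(η * u)) * Real.cos (g i * (u - a)))) :
    ContDiff ℝ (⊤ : ℕ∞) p ∧
    (∀ u, 0 < u → |p u| ≤ (∑ i, |α i|) * Real.exp (-(η * u))) ∧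
    ∫ u in Ioi (0 : ℝ), p u ^ 2 = ∑ i, ∑ j, α i * α j * ((H (g i - g j) + H (g i + g j)) / 2) ∧
    (∀ i, ∫ u in Ioi (0 : ℝ), p u * (Real.exp (-(η * u)) * Real.cos (g i * (u - a))) =
      ∑ j, α j * ((H (g j - g i) + H (g j + g i)) / 2)) ∧
    (∀ i, ∫ u in Ioi (0 : ℝ), p u * (Real.exp (-(η * u)) * Real.sin (g i * (u - a))) =
      ∑ j, α j * ((Q (g i - g j) + Q (g i + g j)) / 2)) := by
  have hpf : p = fun u ↦ ∑ i, α i * (Real.exp (-(η * u)) * Real.cos (g i * (u - a))) := funext hp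
  have hcc : ∀ i j, IntegrableOn (fun u ↦ Real.exp (-(η * u)) * Real.cos (g i * (u - a)) *
      (Real.exp (-(η * u)) * Real.cos (g j * (u - a)))) (Ioi 0) := fun i j ↦
    torusSep_integrableOn_prod hη (by fun_prop) (by fun_prop) (fun u ↦ Real.abs_cos_le_one _)
      (fun u ↦ Real.abs_cos_le_one _)
  have hcs : ∀ i j, IntegrableOn (fun u ↦ Real.exp (-(η * u)) * Real.cos (g i * (u - a)) *
      (Real.exp (-(η * u)) * Real.sin (g j * (u - a)))) (Ioi 0) := fun i j ↦
    torusSep_integrableOn_prod hη (by fun_prop) (by fun_prop) (fun u ↦ Real.abs_cos_le_one _)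
      (fun u ↦ Real.abs_sin_le_one _)
  refine ⟨?_, ?_, ?_, ?_, ?_⟩
  · rw [hpf]
    exact ContDiff.sum fun i _ ↦ contDiff_const.mul (by fun_prop)
  · intro u _
    rw [hp, Finset.sum_mul]
    refine (Finset.abs_sum_le_sum_abs _ _).trans (Finset.sum_le_sum fun i _ ↦ ?_)
    rw [abs_mul, abs_mul, abs_of_pos (Real.exp_pos _)]
    refine mul_le_mul_of_nonneg_left ?_ (abs_nonneg _)
    exact mul_le_of_le_one_right (Real.exp_pos _).le (Real.abs_cos_le_one _)
  · rw [hpf]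
    dsimp only
    rw [torusSep_integral_sum_sq univ _ α fun i _ j _ ↦ hcc i j]
    refine Finset.sum_congr rfl fun i _ ↦ Finset.sum_congr rfl fun j _ ↦ ?_
    rw [torusSep_gram_cc hη a (g i) (g j) hH]
  · intro i
    rw [hpf]
    dsimp only
    rw [torusSep_integral_sum_mul univ _ _ α fun j _ ↦ hcc j i]
    refine Finset.sum_congr rfl fun j _ ↦ ?_
    rw [torusSep_gram_cc hη a (g j) (g i) hH]
  · intro i
    rw [hpf]
    dsimp only
    rw [torusSep_integral_sum_mul univ _ _ α fun j _ ↦ hcs j i]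
    refine Finset.sum_congr rfl fun j _ ↦ ?_
    rw [torusSep_gram_cs hη a (g j) (g i) hQ]

/-! ## The degenerate top layer -/

/-- The energy of `e^{-ηu}` on `(0, ∞)` is `1/(2η)`. [folklore] -/
theorem torusSep_integral_exp_sq {η : ℝ} (hη : 0 < η) :
    ∫ u in Ioi (0 : ℝ), Real.exp (-(η * u)) ^ 2 = 1 / (2 * η) := by
  have e : ∀ u : ℝ, Real.exp (-(η * u)) ^ 2 = Real.exp (-(2 * η) * u) := by
    intro u
    rw [sq, ← Real.exp_add]
    ring_nf
  simp_rw [e]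
  rw [integral_exp_mul_Ioi (by linarith) 0]
  simp only [mul_zero, Real.exp_zero]
  field_simp

/-- **Degenerate top layer.**  If every ordinate of `T` vanishes, the registered conclusion of
TORUS-SEP holds (at `a = 0`, `D = 0`): `gain(0, f) = (Σ w) (∫₀^∞ f e^{-ηu})² ≥ 0`, and a cut-off
of `e^{-ηu}` gains strictly. [folklore] -/
theorem torusSep_degenerate :
    ∀ η₀ : ℝ, 0 < η₀ → ∀ T : Finset ℂ, T.Nonempty → (∀ ρ ∈ T, ρ.re = 1 / 2 + η₀) →
      ∀ w : ℂ → ℝ, (∀ ρ ∈ T, 0 < w ρ) → (∀ ρ ∈ T, ρ.im = 0) →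
      ∃ δ : ℝ, 0 < δ ∧ ∃ a : ℝ, ∃ D : ℝ, 0 ≤ D ∧
        (∀ f : ℝ → ℝ, ContDiff ℝ (⊤ : ℕ∞) f → HasCompactSupport f → tsupport f ⊆ Set.Ici 0 →
          -(∑ ρ ∈ T, w ρ * (Complex.exp (2 * (ρ.im : ℂ) * (a : ℂ) * Complex.I) *
              (∫ u in Set.Ioi (0 : ℝ), (f u : ℂ) * Complex.exp (-((ρ - 1 / 2) * (u : ℂ)))) ^ 2).re)
            ≤ D * ∫ u in Set.Ioi (0 : ℝ), f u ^ 2) ∧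
        (∃ f : ℝ → ℝ, ContDiff ℝ (⊤ : ℕ∞) f ∧ HasCompactSupport f ∧ tsupport f ⊆ Set.Ici 0 ∧
          0 < ∫ u in Set.Ioi (0 : ℝ), f u ^ 2 ∧
          (D + δ) * ∫ u in Set.Ioi (0 : ℝ), f u ^ 2 ≤
            ∑ ρ ∈ T, w ρ * (Complex.exp (2 * (ρ.im : ℂ) * (a : ℂ) * Complex.I) *
              (∫ u in Set.Ioi (0 : ℝ), (f u : ℂ) * Complex.exp (-((ρ - 1 / 2) * (u : ℂ)))) ^ 2).re) := by
  intro η hη T hTne hTre w hw him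
  set W := ∑ ρ ∈ T, w ρ with hW
  have hW0 : 0 < W := Finset.sum_pos hw hTne
  -- the form at `a = 0`
  have hgain : ∀ f : ℝ → ℝ, Continuous f → HasCompactSupport f →
      ∑ ρ ∈ T, w ρ * (Complex.exp (2 * (ρ.im : ℂ) * ((0 : ℝ) : ℂ) * Complex.I) *
        (∫ u in Set.Ioi (0 : ℝ), (f u : ℂ) * Complex.exp (-((ρ - 1 / 2) * (u : ℂ)))) ^ 2).re =
        W * (∫ u in Ioi (0 : ℝ), f u * Real.exp (-(η * u))) ^ 2 := by
    intro f hf hfs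
    rw [Finset.sum_congr rfl fun ρ hρ ↦ by
      rw [torusSep_re_phase_laplace_sq_abs hf hfs (hTre ρ hρ) 0, him ρ hρ]]
    simp only [abs_zero, zero_mul, Real.cos_zero, Real.sin_zero, mul_one, mul_zero,
      integral_zero, sub_zero, zero_pow two_ne_zero]
    rw [hW, Finset.sum_mul]
  -- the gaining profile: a cut-off of `e^{-ηu}`
  have hsel := torusSep_cutoff_select (ι := Unit) hη (p := fun u ↦ Real.exp (-(η * u)))
    (by fun_prop) (A := 1) (fun u _ ↦ by rw [abs_of_pos (Real.exp_pos _), one_mul])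
    (by rw [torusSep_integral_exp_sq hη]; positivity)
    (fun _ u ↦ Real.exp (-(η * u))) (fun _ _ ↦ 0) (fun _ ↦ by fun_prop) (fun _ ↦ continuous_const)
    (fun _ u _ ↦ by rw [abs_of_pos (Real.exp_pos _)]) (fun _ u _ ↦ by
      rw [abs_zero]; exact (Real.exp_pos _).le) (fun _ ↦ W) 0 (by
      simp only [zero_mul, mul_zero, integral_zero, zero_pow two_ne_zero, sub_zero,
        Finset.sum_const, Finset.card_univ, Fintype.card_unit, one_smul]
      refine mul_pos hW0 (pow_pos ?_ 2)
      have e : ∫ u in Ioi (0 : ℝ), Real.exp (-(η * u)) * Real.exp (-(η * u)) = 1 / (2 * η) := by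
        rw [← torusSep_integral_exp_sq hη]
        exact integral_congr_ae (ae_of_all _ fun u ↦ by simp only [sq])
      rw [e]
      positivity)
  obtain ⟨f, hf1, hf2, hf3, hfpos, hfstrict⟩ := hsel
  simp only [zero_mul, mul_zero, integral_zero, zero_pow two_ne_zero, sub_zero,
    Finset.sum_const, Finset.card_univ, Fintype.card_unit, one_smul] at hfstrict
  -- `hfstrict : 0 < W * (∫ f e^{-ηu})²`
  set Γ := W * (∫ u in Ioi (0 : ℝ), f u * Real.exp (-(η * u))) ^ 2 with hΓ
  refine ⟨Γ / ∫ u in Ioi (0 : ℝ), f u ^ 2, div_pos hfstrict hfpos, 0, 0, le_rfl,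
    fun f' hf' hf's _ ↦ ?_, f, hf1, hf2, hf3, hfpos, ?_⟩
  · rw [hgain f' hf'.continuous hf's, zero_mul, neg_nonpos]
    exact mul_nonneg hW0.le (sq_nonneg _)
  · rw [hgain f hf1.continuous hf2, zero_add, div_mul_cancel₀ _ hfpos.ne']

end Summit.RiemannHypothesis.RiemannHypothesis.Theorems.WeilParityOffLineParityDetection

end
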